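import Literature.NumberTheory.Kottwitz1992.ModuliProblem
import Literature.RingTheory.CentralSimple.DoubleCentralizer      -- ★ Voight 7.7.8: `C_B(A)` simple, `C_B(C_B(A)) = A`
import HarnessLib

/-!
# Discharge for the carpet `Kottwitz1992/ModuliProblem` (§5): «`C = End_B(V)` is a simple `ℚ`-algebra with center `F`»

`Kottwitz1992_5_C_simple_holds : ModuliProblem.Kottwitz1992_5_C_simple` (ED. 1).

Topic `Literature/NumberTheory/Kottwitz1992`; namespace `Literature.NumberTheory.Kottwitz1992.ModuliProblemHolds` (squad TK
precedent `KottwitzTriplesHolds` ∕ `FixedPointCountHolds` ∕ `HermitianSymmetricSpacesHolds`: the carpet `ModuliProblem` stays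
statements-only with its import closure; the `_holds` of this CLOSED named fact lives in a sibling proof-lane file because the
proof imports the tree's central-simple-algebra library `Literature.RingTheory.CentralSimple.DoubleCentralizer`).
PROOFS ONLY: no definition, no new named fact, no `sorry`, no `axiom`, no `instance`, no `notation` (net debt −1, D-0026).

Source, verbatim (R. E. Kottwitz, *Points on some Shimura varieties over finite fields*, JAMS 5 (1992), §5 p. 389 = held
`paper:doi-10-2307-2152772` p0017 L16–L17 and L28–L30): «Let `B` be a finite-dimensional simple `ℚ`-algebra with center
`F` […]. Let `V` be a nonzero finitely generated left `B`-module. […] Let `C` be the `ℚ`-algebra `End_B(V)`; it is a simple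
`ℚ`-algebra with center `F` and has an involution `*` coming from the form `⟨·,·⟩`.»  The proof is the double centralizer
theorem in the central simple `ℚ`-algebra `End_ℚ(V)` (the tree's ★ `Literature.RingTheory.CentralSimple.isSimpleRing_centralizer_range`,
★ `centralizer_centralizer_range`, Voight 2021 Prop. 7.7.8 (a), (c)): `C = C_{End V}(ρ B)` is simple, and its centre is
`C ∩ C_{End V}(C) = C ∩ ρ(B) = ρ(Z(B))` (`ρ` is injective because `B` is simple and `V ≠ 0`).

## What is proved (all `theorem`s; `D : PELDatumQ B V` the rational PEL datum of the carpet)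

* `isSimpleRing_moduleEnd` (private) — `End_ℚ(V)` is a simple ring for `V ≠ 0` finite-dimensional (`≅ M_n(ℚ)`).
* `rho_injective` — `ρ : B → End_ℚ(V)` is injective.
* `rho_mem_C_iff` — `ρ(b) ∈ C ⟺ b ∈ Z(B)`.
* `isSimpleRing_C` — `C` is simple.
* `center_C_map_val` — `Z(C) = ρ(Z(B))` inside `End_ℚ(V)`.
* `Kottwitz1992_5_C_simple_holds` — the discharge.

## References

* [Kottwitz1992] §5 p. 389 (p0017 L16–L17, L28–L30).
* [Voight2021] §7.7 Prop. 7.7.8 (the tree's `DoubleCentralizer`, cited there).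
-/

namespace Literature.NumberTheory.Kottwitz1992.ModuliProblemHolds

open Literature.NumberTheory.Kottwitz1992.ModuliProblem
open Literature.RingTheory.CentralSimple Module

universe u v

variable {B : Type u} [Ring B] [Algebra ℚ B] [StarRing B] [StarModule ℚ B] {V : Type v} [AddCommGroup V] [Module ℚ V]

/-- `End_ℚ(V) ≅ M_n(ℚ)` is a simple ring when `V ≠ 0` is finite-dimensional (private plumbing). [folklore] -/
private theorem isSimpleRing_moduleEnd [FiniteDimensional ℚ V] [Nontrivial V] : IsSimpleRing (Module.End ℚ V) := by
  have hn : 0 < finrank ℚ V := finrank_pos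
  haveI : Nonempty (Fin (finrank ℚ V)) := ⟨⟨0, hn⟩⟩
  exact IsSimpleRing.of_ringEquiv (LinearMap.toMatrixAlgEquiv (Module.finBasis ℚ V)).symm.toRingEquiv inferInstance

/-- For the datum of §5, `ρ : B → End_ℚ(V)` is injective («`B` simple», «`V` nonzero», p. 389).
[cite: Kottwitz1992, §5 (p. 389)] -/
theorem rho_injective (D : PELDatumQ B V) : Function.Injective D.ρ := by
  haveI := D.isSimpleRing
  haveI := D.nontrivialV
  exact RingHom.injective (D.ρ : B →+* Module.End ℚ V)

/-- `ρ(b)` lies in `C = End_B(V)` iff `b` is central in `B`. [cite: Kottwitz1992, §5 (p. 389)] -/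
theorem rho_mem_C_iff (D : PELDatumQ B V) (b : B) : D.ρ b ∈ D.C ↔ b ∈ Subalgebra.center ℚ B := by
  rw [PELDatumQ.C, Subalgebra.mem_centralizer_iff, Subalgebra.mem_center_iff]
  constructor
  · intro h b'
    apply rho_injective D
    rw [map_mul, map_mul]
    exact h (D.ρ b') ⟨b', rfl⟩
  · rintro h _ ⟨b', rfl⟩
    rw [← map_mul, ← map_mul, h b']

/-- **«`C = End_B(V)` is a simple `ℚ`-algebra»** (p. 389): the centralizer of the simple `ρ(B)` in the central simple
`End_ℚ(V)` is simple (★ `isSimpleRing_centralizer_range`, Voight 7.7.8 (a)). [cite: Kottwitz1992, §5 (p. 389)] -/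
theorem isSimpleRing_C (D : PELDatumQ B V) : IsSimpleRing D.C := by
  haveI := D.isSimpleRing
  haveI := D.finiteDimensional
  haveI := D.finiteDimensionalV
  haveI := D.nontrivialV
  haveI : IsSimpleRing (Module.End ℚ V) := isSimpleRing_moduleEnd
  exact isSimpleRing_centralizer_range D.ρ

/-- **«with center `F`»** (p. 389): the centre of `C = End_B(V)`, viewed in `End_ℚ(V)`, is the image `ρ(F)` of the centre
`F` of `B` — by the double centralizer theorem `C_{End V}(C) = ρ(B)` (★ `centralizer_centralizer_range`, Voight 7.7.8 (c)),
`Z(C) = C ∩ ρ(B) = ρ(Z(B))`. [cite: Kottwitz1992, §5 (p. 389)] -/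
theorem center_C_map_val (D : PELDatumQ B V) :
    (Subalgebra.center ℚ D.C).map D.C.val = (Subalgebra.center ℚ B).map D.ρ := by
  haveI := D.isSimpleRing
  haveI := D.finiteDimensional
  haveI := D.finiteDimensionalV
  haveI := D.nontrivialV
  haveI : IsSimpleRing (Module.End ℚ V) := isSimpleRing_moduleEnd
  have hcc : Subalgebra.centralizer ℚ (↑(Subalgebra.centralizer ℚ (Set.range D.ρ)) : Set (Module.End ℚ V)) = D.ρ.range :=
    centralizer_centralizer_range D.ρ
  ext x
  simp only [Subalgebra.mem_map]
  constructor
  · rintro ⟨c, hc, rfl⟩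
    rw [Subalgebra.mem_center_iff] at hc
    -- `c` commutes with all of `C`, so `c ∈ C_{End V}(C) = ρ(B)`
    have hx : (c : Module.End ℚ V) ∈ Subalgebra.centralizer ℚ
        (↑(Subalgebra.centralizer ℚ (Set.range D.ρ)) : Set (Module.End ℚ V)) := by
      rw [Subalgebra.mem_centralizer_iff]
      intro y hy
      have := hc ⟨y, hy⟩
      exact congrArg Subtype.val this
    rw [hcc, AlgHom.mem_range] at hx
    obtain ⟨b, hb⟩ := hx
    refine ⟨b, ?_, hb⟩
    rw [← rho_mem_C_iff D, hb]
    exact c.2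
  · rintro ⟨b, hb, rfl⟩
    have hbC : D.ρ b ∈ D.C := (rho_mem_C_iff D b).2 hb
    refine ⟨⟨D.ρ b, hbC⟩, Subalgebra.mem_center_iff.2 fun y => Subtype.ext ?_, rfl⟩
    have hy : (y : Module.End ℚ V) ∈ Subalgebra.centralizer ℚ (Set.range D.ρ) := y.2
    rw [Subalgebra.mem_centralizer_iff] at hy
    exact (hy (D.ρ b) ⟨b, rfl⟩).symm

/-- **«`C = End_B(V)` is a simple `ℚ`-algebra with center `F`» holds** (p. 389, p0017 L28–L30) for every rational PEL datum
of the carpet. [cite: Kottwitz1992, §5 (p. 389)] -/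
theorem Kottwitz1992_5_C_simple_holds : Kottwitz1992_5_C_simple.{u, v} :=
  fun _ _ _ _ _ _ _ _ D => ⟨isSimpleRing_C D, center_C_map_val D⟩

end Literature.NumberTheory.Kottwitz1992.ModuliProblemHolds
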